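import Mathlib.Analysis.SpecialFunctions.PolarCoord
import Mathlib.Analysis.SpecialFunctions.Trigonometric.InverseDeriv
import Mathlib.Analysis.SpecialFunctions.Sqrt
import Mathlib.MeasureTheory.Integral.IntervalIntegral.FundThmCalculus
import Mathlib.MeasureTheory.Measure.Lebesgue.Integral
import Literature.MathematicalPhysics.StatisticalMechanics.HardDiscVirial
import HarnessLib

/-!
# Proof of the third virial coefficient of hard discs (`B₃/B₂² = 4/3 − √3/π`)

Discharges the named fact
`Literature.MathematicalPhysics.StatisticalMechanics.ClisbyMcCoy2004_B3_hardDiscs` of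
`HardDiscVirial.lean`: the Lebesgue volume of the triangle Mayer diagram of hard discs of
diameter `1`,
`hardDiscTriangle = {x : Fin 4 → ℝ | |r₂| < 1, |r₃| < 1, |r₂ − r₃| < 1}` (`r₂ = (x 0, x 1)`,
`r₃ = (x 2, x 3)`), is `V(K₃) = π² − (3√3/4)π`, whence `V(K₃)/3/(π/2)² = 4/3 − √3/π`, the value
printed in [ClisbyMccoy2004, §1] (Tonks 1936; Luban–Baram's formula
`B₃/B₂² = (4Γ(1+D/2)/(π^{1/2}Γ(1/2+D/2))) ∫₀^{π/3}(sin φ)^D dφ` at `D = 2`).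

## The (classical) proof formalised here

1. `x ↦ ![x.1.1, x.1.2, x.2.1, x.2.2] : (ℝ × ℝ) × (ℝ × ℝ) → (Fin 4 → ℝ)` is measure preserving
   (product Lebesgue measures agree on boxes, `Measure.pi_eq`), so `V(K₃)` is the volume of the
   product-form set `{(p, q) | |p| < 1, |q| < 1, |p − q| < 1}`.
2. Tonelli (`Measure.prod_apply`): `V(K₃) = ∫⁻ p, vol {q | |q| < 1, |p − q| < 1}`, the inner set
   being the LENS of two unit discs at distance `|p|` (empty slice if `|p| ≥ 1`).
3. Rotation invariance: an explicit rotation (a linear equivalence of `ℝ × ℝ` taking `p` to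
   `(0, |p|)`) carries the lens at `p` to the standard lens
   `{q | |q| < 1, |q − (0, |p|)| < 1}`; Lebesgue measure on `ℝ × ℝ` is an additive Haar measure,
   so a linear equivalence rescales it by a constant (`Measure.addHaar_preimage_linearEquiv`), and
   the constant is `1` because the unit disc is mapped to itself (no determinant is computed).
4. Lens area: the standard lens at distance `ρ` is the region between `x ↦ ρ − √(1−x²)` and
   `x ↦ √(1−x²)` over `|x| < √(1 − ρ²/4)`; `volume_regionBetween_eq_integral` and the fundamental
   theorem of calculus (antiderivative `arcsin x + x√(1−x²) − ρx`) give the lens area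
   `A(ρ) = 2 arccos(ρ/2) − ρ√(1 − ρ²/4)`.
5. Polar coordinates (`lintegral_comp_polarCoord_symm`): `V(K₃) = 2π ∫₀¹ r·A(r) dr`, and the FTC
   with the antiderivative `r² arccos(r/2) + arcsin(r/2) − r(r²+2)√(1−r²/4)/4` gives
   `∫₀¹ r·A(r) dr = π/2 − 3√3/8`, so `V(K₃) = π² − 3√3π/4`.

All auxiliary results (elementary calculus / measure theory, [folklore]) live in the sub-namespace
`HardDiscTriangleVolume` and are stated with the explicit formula
`A(r) = 2 arccos(r/2) − r√(1 − r²/4)`; no definitions and no named facts are introduced.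

## References

* [ClisbyMccoy2004] N. Clisby, B. M. McCoy, *Analytic calculation of B₄ for hard spheres in even
  dimensions*, J. Stat. Phys. 114 (2004) 1343–1361, §1 (display `B₃/B₂²`, citing L. Tonks,
  Phys. Rev. 50 (1936) 955 and M. Luban, A. Baram, J. Chem. Phys. 76 (1982) 3233).
-/

noncomputable section

open _root_.MeasureTheory _root_.Set _root_.Real intervalIntegral

namespace Literature.MathematicalPhysics.StatisticalMechanics

namespace HardDiscTriangleVolume

/-! ### One-variable calculus: the lens area `A(r) = 2 arccos(r/2) − r√(1 − r²/4)` -/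

/-- `d/dr [r² arccos(r/2) + arcsin(r/2) − r(r²+2)√(1−r²/4)/4] = r · A(r)` on `(−2, 2)`.
[folklore] -/
theorem hasDerivAt_lensAreaPrim {r : ℝ} (h1 : -2 < r) (h2 : r < 2) :
    HasDerivAt (fun r : ℝ => r ^ 2 * arccos (r / 2) + arcsin (r / 2)
        - r * (r ^ 2 + 2) * √(1 - r ^ 2 / 4) / 4)
      (r * (2 * arccos (r / 2) - r * √(1 - r ^ 2 / 4))) r := by
  have hw : 0 < 1 - r ^ 2 / 4 := by nlinarith
  set w := √(1 - r ^ 2 / 4) with hw_def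
  have hw0' : w ≠ 0 := (sqrt_pos.mpr hw).ne'
  have hwsq : w ^ 2 = 1 - r ^ 2 / 4 := sq_sqrt hw.le
  have hr1 : r / 2 ≠ -1 := by intro h; linarith
  have hr2 : r / 2 ≠ 1 := by intro h; linarith
  have hd : HasDerivAt (fun x : ℝ => x / 2) (1 / 2) r := (hasDerivAt_id' r).div_const 2
  have hacos : HasDerivAt (fun x => arccos (x / 2)) (-(1 / √(1 - (r / 2) ^ 2)) * (1 / 2)) r := by
    have h := (hasDerivAt_arccos hr1 hr2).comp r hd
    exact h
  have hasin : HasDerivAt (fun x => arcsin (x / 2)) (1 / √(1 - (r / 2) ^ 2) * (1 / 2)) r := by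
    have h := (hasDerivAt_arcsin hr1 hr2).comp r hd
    exact h
  have hsq' : √(1 - (r / 2) ^ 2) = w := by rw [hw_def]; congr 1; ring
  rw [hsq'] at hacos hasin
  have hin : HasDerivAt (fun x : ℝ => 1 - x ^ 2 / 4) (-(2 * r / 4)) r := by
    simpa using ((hasDerivAt_pow 2 r).div_const 4).const_sub 1
  have hsqrt : HasDerivAt (fun x => √(1 - x ^ 2 / 4)) ((-(2 * r / 4)) / (2 * w)) r := by
    have := hin.sqrt hw.ne'
    rw [← hw_def] at this
    exact this
  have hp : HasDerivAt (fun x : ℝ => x * (x ^ 2 + 2)) (3 * r ^ 2 + 2) r := by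
    have := (hasDerivAt_id' r).fun_mul ((hasDerivAt_pow 2 r).add_const 2)
    refine this.congr_deriv ?_
    norm_num; ring
  have key := (((hasDerivAt_pow 2 r).fun_mul hacos).fun_add hasin).fun_sub
    ((hp.fun_mul hsqrt).div_const 4)
  refine key.congr_deriv ?_
  rw [← hw_def]
  field_simp
  linear_combination (8 * r ^ 2 - 16) * hwsq

/-- `∫_{−c}^{c} (2√(1−x²) − ρ) dx = 2 arcsin c + 2c√(1−c²) − 2ρc` for `0 ≤ c ≤ 1` (FTC with the
antiderivative `arcsin x + x√(1−x²) − ρx`). [folklore] -/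
theorem integral_lens_section {c ρ : ℝ} (hc0 : 0 ≤ c) (hc1 : c ≤ 1) :
    ∫ x in -c..c, (2 * √(1 - x ^ 2) - ρ) =
      2 * arcsin c + 2 * (c * √(1 - c ^ 2)) - 2 * (ρ * c) := by
  have key : ∀ x ∈ Ioo (-c) c, HasDerivAt (fun x => arcsin x + x * √(1 - x ^ 2) - ρ * x)
      (2 * √(1 - x ^ 2) - ρ) x := by
    intro x hx
    have hx1 : -1 < x := by linarith [hx.1]
    have hx2 : x < 1 := by linarith [hx.2]
    have hs : 0 < 1 - x ^ 2 := by nlinarith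
    have h1 : HasDerivAt (fun y : ℝ => 1 - y ^ 2) (-(2 * x)) x := by
      simpa using (hasDerivAt_pow 2 x).const_sub 1
    have h5 := ((hasDerivAt_arcsin hx1.ne' hx2.ne).fun_add
      ((hasDerivAt_id' x).fun_mul (h1.sqrt hs.ne'))).fun_sub ((hasDerivAt_id' x).const_mul ρ)
    refine h5.congr_deriv ?_
    have hsq := sq_sqrt hs.le
    have hne : √(1 - x ^ 2) ≠ 0 := (sqrt_pos.mpr hs).ne'
    field_simp
    linear_combination -hsq
  have hcont : ContinuousOn (fun x => arcsin x + x * √(1 - x ^ 2) - ρ * x) (Icc (-c) c) :=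
    Continuous.continuousOn (by fun_prop)
  have hint : IntervalIntegrable (fun x => 2 * √(1 - x ^ 2) - ρ) volume (-c) c :=
    Continuous.intervalIntegrable (by fun_prop) _ _
  rw [integral_eq_sub_of_hasDerivAt_of_le (by linarith) hcont key hint]
  simp [arcsin_neg]
  ring

/-- The radial moment of the lens area: `∫₀¹ r · A(r) dr = π/2 − 3√3/8`. [folklore] -/
theorem integral_mul_lensArea :
    ∫ r in (0:ℝ)..1, r * (2 * arccos (r / 2) - r * √(1 - r ^ 2 / 4)) = π / 2 - 3 * √3 / 8 := by
  have hcont : ContinuousOn (fun r : ℝ => r ^ 2 * arccos (r / 2) + arcsin (r / 2)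
      - r * (r ^ 2 + 2) * √(1 - r ^ 2 / 4) / 4) (Icc 0 1) :=
    Continuous.continuousOn (by fun_prop)
  have hint : IntervalIntegrable (fun r : ℝ => r * (2 * arccos (r / 2) - r * √(1 - r ^ 2 / 4)))
      volume 0 1 :=
    Continuous.intervalIntegrable (by fun_prop) _ _
  rw [integral_eq_sub_of_hasDerivAt_of_le zero_le_one hcont
    (fun r hr => hasDerivAt_lensAreaPrim (by linarith [hr.1]) (by linarith [hr.2])) hint]
  have h4 : √(4:ℝ) = 2 := by
    rw [show (4:ℝ) = 2 ^ 2 by norm_num, Real.sqrt_sq (by norm_num)]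
  have h34 : √(1 - 1 ^ 2 / 4 : ℝ) = √3 / 2 := by
    rw [show (1 - 1 ^ 2 / 4 : ℝ) = 3 / 4 by norm_num, Real.sqrt_div (by norm_num), h4]
  have hpi : arccos (1 / 2 : ℝ) + arcsin (1 / 2) = π / 2 := by
    rw [arccos_eq_pi_div_two_sub_arcsin]; ring
  rw [h34]
  norm_num
  linear_combination hpi

/-! ### The standard lens `{q | |q| < 1, |q − (0, ρ)| < 1}` and its area -/

/-- For `ρ ≥ 0` the standard lens is the region between `x ↦ ρ − √(1−x²)` and `x ↦ √(1−x²)`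
over `|x| < √(1 − ρ²/4)`. [folklore] -/
theorem lens_eq_regionBetween {ρ : ℝ} (h0 : 0 ≤ ρ) :
    {q : ℝ × ℝ | q.1 ^ 2 + q.2 ^ 2 < 1 ∧ q.1 ^ 2 + (q.2 - ρ) ^ 2 < 1} =
      regionBetween (fun x => ρ - √(1 - x ^ 2)) (fun x => √(1 - x ^ 2))
        (Ioo (-√(1 - ρ ^ 2 / 4)) (√(1 - ρ ^ 2 / 4))) := by
  ext q
  simp only [regionBetween, mem_setOf_eq, mem_Ioo]
  constructor
  · rintro ⟨hq1, hq2⟩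
    have hs : 0 < 1 - q.1 ^ 2 := by nlinarith [sq_nonneg q.2]
    have hA := Real.sq_lt.mp (show q.2 ^ 2 < 1 - q.1 ^ 2 by linarith)
    have hB := Real.sq_lt.mp (show (q.2 - ρ) ^ 2 < 1 - q.1 ^ 2 by nlinarith)
    have hss : √(1 - q.1 ^ 2) ^ 2 = 1 - q.1 ^ 2 := sq_sqrt hs.le
    have hρs : ρ < 2 * √(1 - q.1 ^ 2) := by linarith [hB.1, hA.2]
    have hq : q.1 ^ 2 < 1 - ρ ^ 2 / 4 := by
      nlinarith [mul_pos (show 0 < 2 * √(1 - q.1 ^ 2) - ρ by linarith)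
        (show 0 < 2 * √(1 - q.1 ^ 2) + ρ by linarith)]
    exact ⟨Real.sq_lt.mp hq, by linarith [hB.1], hA.2⟩
  · rintro ⟨hx, hy1, hy2⟩
    have hq : q.1 ^ 2 < 1 - ρ ^ 2 / 4 := Real.sq_lt.mpr hx
    have hs : 0 < 1 - q.1 ^ 2 := by nlinarith
    have hss : √(1 - q.1 ^ 2) ^ 2 = 1 - q.1 ^ 2 := sq_sqrt hs.le
    have hs0 : 0 ≤ √(1 - q.1 ^ 2) := sqrt_nonneg _
    constructor
    · nlinarith [mul_pos (sub_pos.mpr hy2) (show 0 < q.2 + √(1 - q.1 ^ 2) by linarith)]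
    · nlinarith [mul_pos (show 0 < √(1 - q.1 ^ 2) - (q.2 - ρ) by linarith)
        (show 0 < √(1 - q.1 ^ 2) + (q.2 - ρ) by linarith)]

/-- Lens area: the standard lens at distance `ρ ∈ [0, 1]` has volume `A(ρ)`, and `A(ρ) ≥ 0`
(`volume_regionBetween_eq_integral` and `integral_lens_section`). [folklore] -/
theorem volume_lens {ρ : ℝ} (h0 : 0 ≤ ρ) (h1 : ρ ≤ 1) :
    volume {q : ℝ × ℝ | q.1 ^ 2 + q.2 ^ 2 < 1 ∧ q.1 ^ 2 + (q.2 - ρ) ^ 2 < 1} =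
      ENNReal.ofReal (2 * arccos (ρ / 2) - ρ * √(1 - ρ ^ 2 / 4)) ∧
      0 ≤ 2 * arccos (ρ / 2) - ρ * √(1 - ρ ^ 2 / 4) := by
  set c := √(1 - ρ ^ 2 / 4) with hc
  have hc4 : 0 < 1 - ρ ^ 2 / 4 := by nlinarith
  have hc0 : 0 < c := sqrt_pos.mpr hc4
  have hc1 : c ≤ 1 := by rw [hc, sqrt_le_one]; nlinarith
  have hcsq : c ^ 2 = 1 - ρ ^ 2 / 4 := sq_sqrt hc4.le
  have hfg : ∀ x ∈ Ioo (-c) c, ρ - √(1 - x ^ 2) ≤ √(1 - x ^ 2) := by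
    intro x hx
    have hq : x ^ 2 < 1 - ρ ^ 2 / 4 := Real.sq_lt.mpr hx
    have : ρ / 2 ≤ √(1 - x ^ 2) := by
      rw [Real.le_sqrt (by linarith) (by nlinarith)]; nlinarith
    linarith
  have f_int : IntegrableOn (fun x => ρ - √(1 - x ^ 2)) (Ioo (-c) c) volume :=
    (Continuous.integrableOn_Icc (by fun_prop)).mono_set Ioo_subset_Icc_self
  have g_int : IntegrableOn (fun x => √(1 - x ^ 2)) (Ioo (-c) c) volume :=
    (Continuous.integrableOn_Icc (by fun_prop)).mono_set Ioo_subset_Icc_self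
  have hI : ∫ x in Ioo (-c) c, ((fun x => √(1 - x ^ 2)) - fun x => ρ - √(1 - x ^ 2)) x
      = 2 * arccos (ρ / 2) - ρ * c := by
    have : ∫ x in Ioo (-c) c, ((fun x => √(1 - x ^ 2)) - fun x => ρ - √(1 - x ^ 2)) x
        = ∫ x in -c..c, (2 * √(1 - x ^ 2) - ρ) := by
      rw [intervalIntegral.integral_of_le (by linarith), integral_Ioc_eq_integral_Ioo]
      congr 1; funext x; simp only [Pi.sub_apply]; ring
    rw [this, integral_lens_section hc0.le hc1]
    have h2 : √(1 - c ^ 2) = ρ / 2 := by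
      rw [hcsq, show 1 - (1 - ρ ^ 2 / 4) = (ρ / 2) ^ 2 by ring, sqrt_sq (by linarith)]
    have h3 : arccos (ρ / 2) = arcsin c := by
      rw [arccos_eq_arcsin (by linarith), hc]; congr 2; ring
    rw [h2, h3]
    ring
  constructor
  · rw [lens_eq_regionBetween h0, Measure.volume_eq_prod,
      volume_regionBetween_eq_integral f_int g_int measurableSet_Ioo hfg, hI]
  · rw [← hI]
    exact setIntegral_nonneg measurableSet_Ioo
      (fun x hx => by simp only [Pi.sub_apply]; linarith [hfg x hx])

/-! ### Rotation invariance: the lens at a general centre -/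

/-- The open unit disc of `ℝ × ℝ` has nonzero Lebesgue measure. [folklore] -/
theorem volume_disc_ne_zero : volume {q : ℝ × ℝ | q.1 ^ 2 + q.2 ^ 2 < 1} ≠ 0 := by
  have hopen : IsOpen {q : ℝ × ℝ | q.1 ^ 2 + q.2 ^ 2 < 1} :=
    isOpen_lt (by fun_prop) continuous_const
  exact (hopen.measure_pos volume ⟨(0, 0), by simp⟩).ne'

/-- The open unit disc of `ℝ × ℝ` has finite Lebesgue measure. [folklore] -/
theorem volume_disc_ne_top : volume {q : ℝ × ℝ | q.1 ^ 2 + q.2 ^ 2 < 1} ≠ ⊤ := by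
  have hsub : {q : ℝ × ℝ | q.1 ^ 2 + q.2 ^ 2 < 1} ⊆ Ioo (-1 : ℝ) 1 ×ˢ Ioo (-1 : ℝ) 1 := by
    intro q hq
    simp only [mem_setOf_eq] at hq
    have h1 := Real.sq_lt.mp (show q.1 ^ 2 < 1 by nlinarith [sq_nonneg q.2])
    have h2 := Real.sq_lt.mp (show q.2 ^ 2 < 1 by nlinarith [sq_nonneg q.1])
    rw [Real.sqrt_one] at h1 h2
    exact ⟨⟨h1.1, h1.2⟩, ⟨h2.1, h2.2⟩⟩
  refine ((measure_mono hsub).trans_lt ?_).ne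
  rw [Measure.volume_eq_prod, Measure.prod_prod, Real.volume_Ioo]
  exact ENNReal.mul_lt_top (by simp) (by simp)

/-- The lens of unit discs centred at `0` and at `(a, b)` has the volume of the standard lens at
distance `√(a²+b²)`: the rotation `q ↦ ((b q₁ − a q₂)/ρ, (a q₁ + b q₂)/ρ)` (`ρ = √(a²+b²)`, a linear
equivalence) pulls the latter back to the former; a linear equivalence rescales the additive Haar
measure `volume` by a constant (`Measure.addHaar_preimage_linearEquiv`), and the constant is `1`
since the unit disc is pulled back to itself. [folklore] -/
theorem volume_lensAt (a b : ℝ) :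
    volume {q : ℝ × ℝ | q.1 ^ 2 + q.2 ^ 2 < 1 ∧ (a - q.1) ^ 2 + (b - q.2) ^ 2 < 1} =
      volume {q : ℝ × ℝ | q.1 ^ 2 + q.2 ^ 2 < 1 ∧ q.1 ^ 2 + (q.2 - √(a ^ 2 + b ^ 2)) ^ 2 < 1} := by
  set ρ := √(a ^ 2 + b ^ 2) with hρ_def
  have hρsq : ρ ^ 2 = a ^ 2 + b ^ 2 := sq_sqrt (by positivity)
  rcases eq_or_lt_of_le (sqrt_nonneg (a ^ 2 + b ^ 2)) with hρ0 | hρ0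
  · rw [← hρ_def] at hρ0
    have ha : a = 0 := by nlinarith
    have hb : b = 0 := by nlinarith
    congr 1
    ext q
    simp [ha, hb, ← hρ0]
  · rw [← hρ_def] at hρ0
    have h := hρsq.symm
    have hρ : ρ ≠ 0 := hρ0.ne'
    let M : (ℝ × ℝ) ≃ₗ[ℝ] (ℝ × ℝ) :=
      { toFun := fun q => ((b * q.1 - a * q.2) / ρ, (a * q.1 + b * q.2) / ρ)
        invFun := fun u => ((b * u.1 + a * u.2) / ρ, (-a * u.1 + b * u.2) / ρ)
        map_add' := fun x y => by
          ext <;> simp only [Prod.fst_add, Prod.snd_add] <;> ring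
        map_smul' := fun c x => by
          ext <;> simp only [Prod.smul_fst, Prod.smul_snd, smul_eq_mul, RingHom.id_apply] <;> ring
        left_inv := fun q => by
          ext
          · simp only
            field_simp
            linear_combination q.1 * h
          · simp only
            field_simp
            linear_combination q.2 * h
        right_inv := fun u => by
          ext
          · simp only
            field_simp
            linear_combination u.1 * h
          · simp only
            field_simp
            linear_combination u.2 * h }
    have hMq : ∀ q : ℝ × ℝ, M q = ((b * q.1 - a * q.2) / ρ, (a * q.1 + b * q.2) / ρ) :=
      fun q => rfl
    have hnorm : ∀ q : ℝ × ℝ, (M q).1 ^ 2 + (M q).2 ^ 2 = q.1 ^ 2 + q.2 ^ 2 := by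
      intro q
      rw [hMq]
      field_simp
      linear_combination -(q.1 ^ 2 + q.2 ^ 2) * hρsq
    have hdist : ∀ q : ℝ × ℝ,
        (M q).1 ^ 2 + ((M q).2 - ρ) ^ 2 = (a - q.1) ^ 2 + (b - q.2) ^ 2 := by
      intro q
      rw [hMq]
      field_simp
      linear_combination (ρ ^ 2 - q.1 ^ 2 - q.2 ^ 2) * hρsq
    have hD : (M : ℝ × ℝ → ℝ × ℝ) ⁻¹' {q | q.1 ^ 2 + q.2 ^ 2 < 1} =
        {q | q.1 ^ 2 + q.2 ^ 2 < 1} := by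
      ext q
      simp only [mem_preimage, mem_setOf_eq, hnorm q]
    have hL : (M : ℝ × ℝ → ℝ × ℝ) ⁻¹' {q | q.1 ^ 2 + q.2 ^ 2 < 1 ∧ q.1 ^ 2 + (q.2 - ρ) ^ 2 < 1} =
        {q | q.1 ^ 2 + q.2 ^ 2 < 1 ∧ (a - q.1) ^ 2 + (b - q.2) ^ 2 < 1} := by
      ext q
      simp only [mem_preimage, mem_setOf_eq, hnorm q, hdist q]
    have hκ : ENNReal.ofReal |LinearMap.det (M.symm : ℝ × ℝ →ₗ[ℝ] ℝ × ℝ)| = 1 := by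
      have key := Measure.addHaar_preimage_linearEquiv volume M
        {q : ℝ × ℝ | q.1 ^ 2 + q.2 ^ 2 < 1}
      rw [hD] at key
      nth_rewrite 1 [← one_mul (volume {q : ℝ × ℝ | q.1 ^ 2 + q.2 ^ 2 < 1})] at key
      exact ((ENNReal.mul_left_inj volume_disc_ne_zero volume_disc_ne_top).mp key).symm
    rw [← hL, Measure.addHaar_preimage_linearEquiv, hκ, one_mul]

/-! ### The triangle diagram in product coordinates; Tonelli and polar coordinates -/

/-- The triangle configuration set in product coordinates `(r₂, r₃) ∈ (ℝ × ℝ) × (ℝ × ℝ)` is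
measurable. [folklore] -/
theorem measurableSet_triangleProd : MeasurableSet {x : (ℝ × ℝ) × (ℝ × ℝ) |
      x.1.1 ^ 2 + x.1.2 ^ 2 < 1 ∧ x.2.1 ^ 2 + x.2.2 ^ 2 < 1 ∧
        (x.1.1 - x.2.1) ^ 2 + (x.1.2 - x.2.2) ^ 2 < 1} := by
  simp only [setOf_and]
  refine MeasurableSet.inter ?_ (MeasurableSet.inter ?_ ?_) <;>
    exact measurableSet_lt (by fun_prop) (by fun_prop)

/-- The `r₂`-slices of the triangle set: the lens at `r₂` if `|r₂| < 1`, empty otherwise; hence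
their volume is `A(|r₂|)`, resp. `0`. [folklore] -/
theorem volume_slice_triangleProd (p : ℝ × ℝ) :
    volume (Prod.mk p ⁻¹' {x : (ℝ × ℝ) × (ℝ × ℝ) |
      x.1.1 ^ 2 + x.1.2 ^ 2 < 1 ∧ x.2.1 ^ 2 + x.2.2 ^ 2 < 1 ∧
        (x.1.1 - x.2.1) ^ 2 + (x.1.2 - x.2.2) ^ 2 < 1}) =
      if p.1 ^ 2 + p.2 ^ 2 < 1 then ENNReal.ofReal (2 * arccos (√(p.1 ^ 2 + p.2 ^ 2) / 2) -
        √(p.1 ^ 2 + p.2 ^ 2) * √(1 - √(p.1 ^ 2 + p.2 ^ 2) ^ 2 / 4)) else 0 := by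
  split_ifs with hp
  · have : Prod.mk p ⁻¹' {x : (ℝ × ℝ) × (ℝ × ℝ) |
        x.1.1 ^ 2 + x.1.2 ^ 2 < 1 ∧ x.2.1 ^ 2 + x.2.2 ^ 2 < 1 ∧
          (x.1.1 - x.2.1) ^ 2 + (x.1.2 - x.2.2) ^ 2 < 1} =
        {q : ℝ × ℝ | q.1 ^ 2 + q.2 ^ 2 < 1 ∧ (p.1 - q.1) ^ 2 + (p.2 - q.2) ^ 2 < 1} := by
      ext q; simp [hp]
    rw [this, volume_lensAt]
    exact (volume_lens (sqrt_nonneg _) (sqrt_le_one.mpr hp.le)).1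
  · have : Prod.mk p ⁻¹' {x : (ℝ × ℝ) × (ℝ × ℝ) |
        x.1.1 ^ 2 + x.1.2 ^ 2 < 1 ∧ x.2.1 ^ 2 + x.2.2 ^ 2 < 1 ∧
          (x.1.1 - x.2.1) ^ 2 + (x.1.2 - x.2.2) ^ 2 < 1} = ∅ := by
      ext q; simp [hp]
    rw [this, measure_empty]

/-- The radial profile `r ↦ 𝟙(r < 1) · r · A(r)` (`ℝ≥0∞`-valued) is measurable. [folklore] -/
theorem measurable_radialProfile : Measurable fun r : ℝ =>
    if r < 1 then ENNReal.ofReal (r * (2 * arccos (r / 2) - r * √(1 - r ^ 2 / 4))) else 0 := by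
  have hc : Continuous fun r : ℝ => r * (2 * arccos (r / 2) - r * √(1 - r ^ 2 / 4)) := by
    fun_prop
  exact Measurable.ite measurableSet_Iio (ENNReal.continuous_ofReal.comp hc).measurable
    measurable_const

/-- `∫⁻_{r > 0} 𝟙(r < 1) · r · A(r) = π/2 − 3√3/8` (from `integral_mul_lensArea`). [folklore] -/
theorem lintegral_radialProfile :
    ∫⁻ r in Ioi 0, (if r < 1 then
        ENNReal.ofReal (r * (2 * arccos (r / 2) - r * √(1 - r ^ 2 / 4))) else 0) =
      ENNReal.ofReal (π / 2 - 3 * √3 / 8) := by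
  have hΨ : (fun r : ℝ => if r < 1 then
      ENNReal.ofReal (r * (2 * arccos (r / 2) - r * √(1 - r ^ 2 / 4))) else 0) =
      (Iio 1).indicator
        (fun r => ENNReal.ofReal (r * (2 * arccos (r / 2) - r * √(1 - r ^ 2 / 4)))) := by
    funext r; simp only [Set.indicator_apply, mem_Iio]
  rw [hΨ, lintegral_indicator measurableSet_Iio, Measure.restrict_restrict measurableSet_Iio,
    Iio_inter_Ioi]
  have hint : IntegrableOn (fun r : ℝ => r * (2 * arccos (r / 2) - r * √(1 - r ^ 2 / 4)))
      (Ioo 0 1) volume :=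
    (Continuous.integrableOn_Icc (by fun_prop)).mono_set Ioo_subset_Icc_self
  have hnn : 0 ≤ᵐ[volume.restrict (Ioo (0:ℝ) 1)]
      fun r : ℝ => r * (2 * arccos (r / 2) - r * √(1 - r ^ 2 / 4)) := by
    filter_upwards [ae_restrict_mem measurableSet_Ioo] with r hr
    exact mul_nonneg hr.1.le (volume_lens hr.1.le hr.2.le).2
  rw [← ofReal_integral_eq_lintegral_ofReal hint hnn, ← integral_Ioc_eq_integral_Ioo,
    ← intervalIntegral.integral_of_le zero_le_one, integral_mul_lensArea]

/-- Volume of the triangle set in product coordinates: `(π/2 − 3√3/8) · 2π` — Tonelli over the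
`r₂`-slices, then polar coordinates for `r₂`. [folklore] -/
theorem volume_triangleProd :
    volume {x : (ℝ × ℝ) × (ℝ × ℝ) | x.1.1 ^ 2 + x.1.2 ^ 2 < 1 ∧ x.2.1 ^ 2 + x.2.2 ^ 2 < 1 ∧
        (x.1.1 - x.2.1) ^ 2 + (x.1.2 - x.2.2) ^ 2 < 1} =
      ENNReal.ofReal (π / 2 - 3 * √3 / 8) * ENNReal.ofReal (2 * π) := by
  rw [Measure.volume_eq_prod, Measure.prod_apply measurableSet_triangleProd,
    ← lintegral_comp_polarCoord_symm]
  have heq : EqOn (fun x : ℝ × ℝ => ENNReal.ofReal x.1 •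
      volume (Prod.mk (polarCoord.symm x) ⁻¹' {x : (ℝ × ℝ) × (ℝ × ℝ) |
        x.1.1 ^ 2 + x.1.2 ^ 2 < 1 ∧ x.2.1 ^ 2 + x.2.2 ^ 2 < 1 ∧
          (x.1.1 - x.2.1) ^ 2 + (x.1.2 - x.2.2) ^ 2 < 1}))
      (fun x => if x.1 < 1 then
        ENNReal.ofReal (x.1 * (2 * arccos (x.1 / 2) - x.1 * √(1 - x.1 ^ 2 / 4))) else 0)
      polarCoord.target := by
    intro x hx
    have hr : 0 < x.1 := hx.1
    simp only [volume_slice_triangleProd, polarCoord_symm_apply, smul_eq_mul]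
    have hsq : (x.1 * cos x.2) ^ 2 + (x.1 * sin x.2) ^ 2 = x.1 ^ 2 := by
      linear_combination x.1 ^ 2 * (cos_sq_add_sin_sq x.2)
    rw [hsq, sqrt_sq hr.le]
    by_cases h1 : x.1 < 1
    · have : x.1 ^ 2 < 1 := by nlinarith
      rw [if_pos this, if_pos h1, ENNReal.ofReal_mul hr.le]
    · have : ¬ x.1 ^ 2 < 1 := by intro h; apply h1; nlinarith
      rw [if_neg this, if_neg h1, mul_zero]
  rw [setLIntegral_congr_fun polarCoord.open_target.measurableSet heq, polarCoord_target,
    Measure.volume_eq_prod, ← Measure.prod_restrict,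
    lintegral_prod (fun x : ℝ × ℝ => if x.1 < 1 then
        ENNReal.ofReal (x.1 * (2 * arccos (x.1 / 2) - x.1 * √(1 - x.1 ^ 2 / 4))) else 0)
      (measurable_radialProfile.comp measurable_fst).aemeasurable]
  simp only [lintegral_const, Measure.restrict_apply_univ, Real.volume_Ioo]
  rw [lintegral_mul_const _ measurable_radialProfile, lintegral_radialProfile]
  congr 1
  ring_nf

/-- The same volume as a real number: `π² − 3√3π/4`. [folklore] -/
theorem volume_triangleProd_toReal :
    (volume {x : (ℝ × ℝ) × (ℝ × ℝ) | x.1.1 ^ 2 + x.1.2 ^ 2 < 1 ∧ x.2.1 ^ 2 + x.2.2 ^ 2 < 1 ∧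
        (x.1.1 - x.2.1) ^ 2 + (x.1.2 - x.2.2) ^ 2 < 1}).toReal = π ^ 2 - 3 * √3 * π / 4 := by
  have h3 : √3 < 2 := by
    rw [show (2:ℝ) = √4 by rw [show (4:ℝ) = 2 ^ 2 by norm_num, sqrt_sq (by norm_num)]]
    exact sqrt_lt_sqrt (by norm_num) (by norm_num)
  have h1 : 0 ≤ π / 2 - 3 * √3 / 8 := by nlinarith [Real.two_le_pi]
  rw [volume_triangleProd, ENNReal.toReal_mul, ENNReal.toReal_ofReal h1,
    ENNReal.toReal_ofReal (by positivity)]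
  ring

/-! ### From `Fin 4 → ℝ` to `(ℝ × ℝ) × (ℝ × ℝ)` -/

/-- The coordinate map `((x₀, x₁), (x₂, x₃)) ↦ ![x₀, x₁, x₂, x₃]` is measurable. [folklore] -/
theorem measurable_toFin4 :
    Measurable fun x : (ℝ × ℝ) × (ℝ × ℝ) => (![x.1.1, x.1.2, x.2.1, x.2.2] : Fin 4 → ℝ) := by
  refine measurable_pi_lambda _ (fun i => ?_)
  fin_cases i
  · exact measurable_fst.fst
  · exact measurable_fst.snd
  · exact measurable_snd.fst
  · exact measurable_snd.snd

/-- The coordinate map carries the product Lebesgue measure of `(ℝ × ℝ) × (ℝ × ℝ)` to that of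
`Fin 4 → ℝ` (both give a box the product of its side lengths; `Measure.pi_eq`). [folklore] -/
theorem measurePreserving_toFin4 : MeasurePreserving
    (fun x : (ℝ × ℝ) × (ℝ × ℝ) => (![x.1.1, x.1.2, x.2.1, x.2.2] : Fin 4 → ℝ)) volume volume := by
  refine ⟨measurable_toFin4, ?_⟩
  symm
  rw [volume_pi]
  refine Measure.pi_eq (fun s hs => ?_)
  rw [Measure.map_apply measurable_toFin4 (MeasurableSet.univ_pi hs)]
  have : (fun x : (ℝ × ℝ) × (ℝ × ℝ) => (![x.1.1, x.1.2, x.2.1, x.2.2] : Fin 4 → ℝ)) ⁻¹'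
      (Set.pi univ s) = (s 0 ×ˢ s 1) ×ˢ (s 2 ×ˢ s 3) := by
    ext x
    simp only [mem_preimage, mem_univ_pi, mem_prod]
    constructor
    · intro h; exact ⟨⟨h 0, h 1⟩, h 2, h 3⟩
    · rintro ⟨⟨h0, h1⟩, h2, h3⟩ i
      fin_cases i <;> assumption
  rw [this, Measure.volume_eq_prod, Measure.prod_prod, Measure.volume_eq_prod, Measure.prod_prod,
    Measure.prod_prod, Fin.prod_univ_four]
  ring

/-- `hardDiscTriangle` is measurable. [folklore] -/
theorem measurableSet_hardDiscTriangle : MeasurableSet hardDiscTriangle := by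
  simp only [hardDiscTriangle, setOf_and]
  refine MeasurableSet.inter ?_ (MeasurableSet.inter ?_ ?_) <;>
    exact measurableSet_lt (by fun_prop) (by fun_prop)

end HardDiscTriangleVolume

open HardDiscTriangleVolume in
/-- **Volume of the triangle Mayer diagram of hard discs** (Tonks 1936, as restated in
Clisby–McCoy 2004 §1): `V(K₃) = vol(hardDiscTriangle) = π² − (3√3/4)π`.
[cite: ClisbyMccoy2004, §1 (display B₃/B₂² at D = 2, with B₃ = V(K₃)/3, B₂ = π/2)] -/
theorem volume_hardDiscTriangle_toReal :
    (volume hardDiscTriangle).toReal = π ^ 2 - 3 * √3 * π / 4 := by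
  have hpre : (fun x : (ℝ × ℝ) × (ℝ × ℝ) => (![x.1.1, x.1.2, x.2.1, x.2.2] : Fin 4 → ℝ)) ⁻¹'
      hardDiscTriangle = {x : (ℝ × ℝ) × (ℝ × ℝ) | x.1.1 ^ 2 + x.1.2 ^ 2 < 1 ∧
        x.2.1 ^ 2 + x.2.2 ^ 2 < 1 ∧ (x.1.1 - x.2.1) ^ 2 + (x.1.2 - x.2.2) ^ 2 < 1} := by
    ext x
    simp [hardDiscTriangle]
  rw [← measurePreserving_toFin4.measure_preimage
    measurableSet_hardDiscTriangle.nullMeasurableSet, hpre, volume_triangleProd_toReal]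

/-- **Third virial coefficient of hard discs** — discharge of the named fact
`ClisbyMcCoy2004_B3_hardDiscs`: `V(K₃)/3/(π/2)² = 4/3 − √3/π`, i.e. `B₃/B₂² = 4/3 − √3/π`
(Tonks 1936; Luban–Baram 1982 at `D = 2`).
[cite: ClisbyMccoy2004, §1 (display B₃/B₂² = 4Γ(1+D/2)/(π^{1/2}Γ(1/2+D/2)) ∫₀^{π/3} (sin φ)^D dφ, D = 2)] -/
theorem ClisbyMcCoy2004_B3_hardDiscs_holds : ClisbyMcCoy2004_B3_hardDiscs := by
  unfold ClisbyMcCoy2004_B3_hardDiscs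
  rw [volume_hardDiscTriangle_toReal]
  have hπ : π ≠ 0 := pi_ne_zero
  field_simp
  ring

end Literature.MathematicalPhysics.StatisticalMechanics

end
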